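import Literature.Computability.Cryptography.ShorTheoremAssembly
import Literature.Computability.Cryptography.ShorStepFP
import Literature.Computability.Cryptography.KitaevFamilyUniform
import Literature.Computability.Cryptography.OrderFindingPostFP
import HarnessLib

/-!
# Shor's theorem `FACT ∈ BQP`: the assembly over a classical base machine

Family `PQC`; a second assembly of the named fact `Literature.Computability.Cryptography.FACT_mem_BQP`
(Shor 1997, §5, decision form) next to `ShorTheoremAssembly.lean`. There `isQSolvable_factoring` is
obtained from the classical part `shorClassical ∈ FP^{orderBitLang}` through two infrastructure facts
of `ShorAssembly.lean`: the coin/reversible-simulation principle with *oracle gates*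
(`kernelProb_ge_uniformProb_of_mem_FPRel`, Bernstein–Vazirani 1997, Thm. 8.3 relativised) and the
replacement of oracle gates by `BQP` deciders inside an *arbitrary* uniform quantum family
(`isQSolvable_of_mem_BQP_oracle`, Bennett–Bernstein–Brassard–Vazirani 1997, Thm. 4.14 / Cor. 4.15 —
which needs *tidy* subroutines, since a quantum family may interfere after its queries).

Shor's use of the order-finding subroutine is classical: the base machine is a randomised
polynomial-time oracle machine, all its registers stay computational-basis labels between queries,
and everything is measured at the end; for such a caller the output distribution of "copy the query,
run an amplified decider on the copy, continue with its answer bit" is exactly that of the classical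
machine with a noisy oracle (orthogonal histories never recombine), so no uncomputation of the
subroutine's garbage is required. This file therefore isolates the single principle actually used —
**`isQSolvable_of_mem_FPRel_BQP`: search problems solved with probability `≥ 3/4` by a randomised
polynomial-time machine with an oracle in `BQP` are solvable in bounded-error quantum polynomial time
("`BPP^{BQP}` search ⊆ `FBQP`", a corollary of `BQP^{BQP} = BQP`, BBBV 1997, Cor. 4.15, with
Bernstein–Vazirani 1997, Thm. 8.3)** — proves that it follows from the two facts above
(`isQSolvable_of_mem_FPRel_BQP_of`), and re-assembles Shor's theorem from it:

* `isQSolvable_factoring_of_classicalBase : isQSolvable_of_mem_FPRel_BQP → orderBitLang ∈ BQP →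
  isQSolvable_factoring` (with the now unconditional `shorClassical_mem_FPRel_holds` of `ShorStepFP.lean`
  and `Shor1997.shorClassical_success`);
* `FACT_mem_BQP_of_facts' : isQSolvable_classicalWrap → Kitaev1995_orderFindingFamily →
  orderFindingPost_mem_FP → isQSolvable_of_mem_FPRel_BQP → FACT_mem_BQP` (four named facts instead of
  seven).

## References

* C. H. Bennett, E. Bernstein, G. Brassard, U. Vazirani, *Strengths and weaknesses of quantum
  computing*, SIAM J. Comput. 26 (1997) 1510–1523, Thm. 4.14 and Cor. 4.15 (`BQP^{BQP} = BQP`).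
* E. Bernstein, U. Vazirani, *Quantum complexity theory*, SIAM J. Comput. 26 (1997), Thm. 8.3
  (`BPP ⊆ BQP`) and §8.3 (oracle machines).
* P. W. Shor, SIAM J. Comput. 26 (1997) 1484–1509, §5 (pp. 13–16 of arXiv:quant-ph/9508027v2: the
  classical randomised reduction around the order-finding subroutine).
-/

noncomputable section

namespace Literature.Computability.Cryptography

open _root_.Computability Complexity QuantumComplexity

/-- **Randomised classical polynomial time with a `BQP` oracle, search form** ("`BPP^{BQP}`
search problems are in `FBQP`"; a corollary of `BQP^{BQP} = BQP`, Bennett–Bernstein–Brassard–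
Vazirani 1997, Cor. 4.15, together with Bernstein–Vazirani 1997, Thm. 8.3: a randomised
polynomial-time oracle machine is a special oracle quantum machine — Hadamard coins followed by a
reversible simulation). Statement over the tree's models: if `A ∈ BQP`, `G ∈ FP^A`
(`FPRel (Oracle.ofLanguage A)`, a G01 polynomial-time oracle algorithm), `q` is a coin polynomial,
the relation `R` is closed under extension of the output string (the tree's convention: all wires
are measured, only a prefix is read), and for every input `x` the coin strings
`c ∈ {0,1}^{q(|x|)}` with `G ⟨x, c⟩ ∈ R x` have probability `≥ 3/4`, then `R` is solvable in
bounded-error quantum polynomial time (`IsQSolvable R`, success `≥ 2/3`; the slack `1/12` absorbs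
the simulation of the oracle answers by amplified deciders of `A`). For a *classical* caller —
registers are basis labels between queries and everything is measured at the end — the
replacement of each query by "copy the query, run an amplified decider on the copy, keep its answer
bit" reproduces the output distribution of the classical machine with a noisy oracle, without the
tidy uncomputation that a quantum caller (Thm. 4.14) requires; `isQSolvable_of_mem_FPRel_BQP_of`
records that the statement is also a consequence of the two general facts
`kernelProb_ge_uniformProb_of_mem_FPRel` and `isQSolvable_of_mem_BQP_oracle` of `ShorAssembly.lean`.
[cite: BennettBernsteinBrassardVazirani1997, Cor. 4.15 (BQP^BQP = BQP) with Thm. 4.14; BernsteinVazirani1997SICOMP Thm. 8.3] -/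
def isQSolvable_of_mem_FPRel_BQP : Prop :=
  ∀ (A : Language Bool) (G : List Bool → List Bool) (q : Polynomial ℕ) (R : List Bool → Set (List Bool)),
    (∀ x, ∀ y ∈ R x, ∀ z, y <+: z → z ∈ R x) →
    A ∈ BQP → G ∈ FPRel (Oracle.ofLanguage A) →
    (∀ x, 3 / 4 ≤ uniformProb (q.eval x.length) {c | G (boolPair x c) ∈ R x}) → IsQSolvable R

/-- A relation closed under extension contains exactly the strings with a prefix in it. [folklore] -/
theorem setOf_exists_prefix_eq {S : Set (List Bool)} (hS : ∀ y ∈ S, ∀ z, y <+: z → z ∈ S) :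
    {y | ∃ s ∈ S, s <+: y} = S := by
  ext y
  exact ⟨fun ⟨s, hs, hsy⟩ => hS s hs y hsy, fun hy => ⟨y, hy, List.prefix_rfl⟩⟩

/-- **The classical-base principle follows from the two general facts** of `ShorAssembly.lean`:
simulate the oracle machine on coins with oracle gates (`kernelProb_ge_uniformProb_of_mem_FPRel`),
then replace the oracle gates by deciders of `A` with slack `1/12`
(`isQSolvable_of_mem_BQP_oracle`). [cite: BennettBernsteinBrassardVazirani1997, Cor. 4.15; BernsteinVazirani1997SICOMP Thm. 8.3] -/
theorem isQSolvable_of_mem_FPRel_BQP_of (hsub : isQSolvable_of_mem_BQP_oracle)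
    (hsim : kernelProb_ge_uniformProb_of_mem_FPRel) : isQSolvable_of_mem_FPRel_BQP := by
  intro A G q R hR hA hG hprob
  obtain ⟨F, hunif, hF⟩ := hsim A G q hG
  refine hsub A R F (1 / 12) hR hA hunif (by norm_num) fun x => ?_
  have h := hF x (R x)
  rw [setOf_exists_prefix_eq (hR x)] at h
  have := hprob x
  linarith

/-- **Shor's theorem, FBQP form, over a classical base**: if the order-bit language is in `BQP`,
the prime factorisation is in `FBQP` (`isQSolvable_factoring`) — the classical part
`shorClassical ∈ FP^{orderBitLang}` (`shorClassical_mem_FPRel_holds`) succeeds with probability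
`≥ 3/4` over its `64 (L+1)³` coins (`Shor1997.shorClassical_success`), and the target relation
`{y | factorisation <+: y}` is closed under extension. [cite: Shor1997SICOMP, §5 (factoring in quantum polynomial time)] -/
theorem isQSolvable_factoring_of_classicalBase (hbase : isQSolvable_of_mem_FPRel_BQP)
    (hA : orderBitLang ∈ BQP) : isQSolvable_factoring := by
  refine hbase orderBitLang Shor1997.shorClassical coinPoly _ (fun x y hy z hyz => List.IsPrefix.trans hy hyz) hA
    shorClassical_mem_FPRel_holds fun x => ?_
  have hs := Shor1997.shorClassical_success x
  rw [← coinPoly_eval] at hs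
  refine hs.trans (uniformProb_mono _ fun c hc => ?_)
  simp only [Set.mem_setOf_eq, Shor1997.shorClassical_boolPair] at hc ⊢
  rw [hc]

/-- **Shor's theorem, FBQP form, from four named facts**: classical wrapping
(`isQSolvable_classicalWrap`), Kitaev's uniform family with its clean modular-exponentiation block
(`Kitaev1995_orderFindingFamily`), the polynomial-time post-processor (`orderFindingPost_mem_FP`)
— these three give `orderBitLang ∈ BQP` (`orderBitLang_mem_BQP_of`, `Shor1997_orderFinding_isQSolvable_of`,
with the discharged `ordPost_mem_FP_holds`) — and the classical-base principle
(`isQSolvable_of_mem_FPRel_BQP`). [cite: Shor1997SICOMP, §5 (Theorem on factoring)] -/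
theorem isQSolvable_factoring_of_facts' (hwrap : isQSolvable_classicalWrap)
    (hfam : Kitaev1995_orderFindingFamily) (hpostOF : orderFindingPost_mem_FP)
    (hbase : isQSolvable_of_mem_FPRel_BQP) : isQSolvable_factoring :=
  isQSolvable_factoring_of_classicalBase hbase
    (orderBitLang_mem_BQP_of hwrap ordPost_mem_FP_holds (Shor1997_orderFinding_isQSolvable_of hwrap hfam hpostOF))

/-- **Shor's theorem `FACT ∈ BQP` from four named facts** (`FACT_mem_BQP_of_wrap`, `ShorFactPost`,
on top of `isQSolvable_factoring_of_facts'`). [cite: Shor1997SICOMP, §5] -/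
theorem FACT_mem_BQP_of_facts' (hwrap : isQSolvable_classicalWrap)
    (hfam : Kitaev1995_orderFindingFamily) (hpostOF : orderFindingPost_mem_FP)
    (hbase : isQSolvable_of_mem_FPRel_BQP) : FACT_mem_BQP :=
  FACT_mem_BQP_of_wrap hwrap (isQSolvable_factoring_of_facts' hwrap hfam hpostOF hbase)

/-- **Shor's theorem `FACT ∈ BQP` from the two remaining infrastructure facts.** With Kitaev's family
discharged (`Kitaev1995_orderFindingFamily_holds`, `KitaevFamilyUniform.lean`) and the post-processor
polynomial time (`orderFindingPost_mem_FP_holds`, `OrderFindingPostFP.lean`), `FACT_mem_BQP` follows from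
classical wrapping inside bounded-error quantum search (`isQSolvable_classicalWrap`, Bernstein–Vazirani
1997, §8) and the classical-base principle (`isQSolvable_of_mem_FPRel_BQP`, "`BPP^{BQP}` search ⊆ `FBQP`",
Bennett–Bernstein–Brassard–Vazirani 1997, Cor. 4.15): every Shor-specific part of the proof — the
reduction and its recursion, the order-finding experiment and its analysis, the modular-exponentiation
block, its uniformity, and all classical programs — is now proved in the tree. [cite: Shor1997SICOMP, §5 (Theorem on factoring)] -/
theorem FACT_mem_BQP_of_wrap_base (hwrap : isQSolvable_classicalWrap) (hbase : isQSolvable_of_mem_FPRel_BQP) :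
    FACT_mem_BQP :=
  FACT_mem_BQP_of_facts' hwrap Kitaev1995_orderFindingFamily_holds orderFindingPost_mem_FP_holds hbase

/-- The same for the `FBQP` form `isQSolvable_factoring`. [cite: Shor1997SICOMP, §5 (Theorem on factoring)] -/
theorem isQSolvable_factoring_of_wrap_base (hwrap : isQSolvable_classicalWrap)
    (hbase : isQSolvable_of_mem_FPRel_BQP) : isQSolvable_factoring :=
  isQSolvable_factoring_of_facts' hwrap Kitaev1995_orderFindingFamily_holds orderFindingPost_mem_FP_holds hbase

end Literature.Computability.Cryptography

end
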